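import Summits.QuantumFields.BalabanUV.Beta.E3CoDressedContact

/-!
# Beta / E3CoDressedContactLevelOne — the level-1 contact of the value-function jet over the CO-DRESSED one-step resolvent, closed form
# (β sub-cell, row D1, hR leaf (L3) re-typed (L3-D); unit `b2b-balaban-beta-an3` gen 30, node «E3-CONTACT-EVAL-L1»; file 2 of 2)

HONEST FRAMING.  Discharging `BetaPertH` makes Balaban's ultraviolet stability UNCONDITIONAL — a real constructive-QFT result; it
is NOT the continuum limit and NOT the Clay problem.  HONEST DEPENDENCY: continuum YM on `T⁴` ⇐ `BetaPertH` ∧ nine spine estimates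
(0/9 proved); `BetaPertH` ⇐ (D1) ∧ (D4) ∧ CAP+tail.  This module is NOT (D1) and NOT `BetaPertH`: it is neutral kernel algebra over
the tree's own definitions ([folklore]); nothing here is a cited fact, no definition is introduced.

WHAT IS EVALUATED.  Let `Ĝ := coDressKBmAt (ctr (d+1) Lc) Lc KInv` be the `Π_bm`-co-dressed one-step resolvent (the wall kernel `G₀`,
`BorderedHessian.relInv_coDressKBmAt_KInvStep_zero_bhKAt`, `RelInvBorderedHessian.KInvStep_zero_eq`).  By
`E3GenericReflection.neg_mmRead_sandwich_vertexOfK_S0NAt_bref` (p210430) the `Ĝ`-generic level-1 value-function jet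
`e3OfK Lc Ĝ S0NAt κ′ u = −mmRead Lc (Ĝ ∘ V_Ĝ κ′ u ∘ Ĝ)` obeys the reflection law with the CONTACT
`−mmRead Lc (Ĝ ∘ conjV (bhKAt ρ_c Lc) ((cVH/Lc^{d+1}) • diagK Gᵛ) ∘ Ĝ)`, `Gᵛ` the `ℋ`-dressed generator (file 1, §2).  Here, in closed form:

* §1 the instance data: `Ĝ` is spread, `refK (Φ Lc α)`-invariant (odd `Lc`) and `RelInv Ĝ (bhKAt ρ_c Lc) (axEc ρ_c Lc)` (an2's gen-13/14
  rules, BY NAME); RULE `E∘𝕄∘A = E` READ ON A COARSE MULTIPLIER ENTRY, `σ = 1` (`sum_tsum_colH_mul_linKerAt_of_EMA`).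
* §2 `neg_mmRead_contact_sandwich`: the contact is `mmRead Lc (conjV Ĝ (diagK ((cVH/Lc^{d+1})·Gᵛ)))`; on field–field entries
  `(cVH/Lc^{d+1}) · KInv (Lc•x′) (Lc•z′) (inr a) (inr b) · (Gᵛ (Lc•z′) (inr b) − Gᵛ (Lc•x′) (inr a))` (`coDressKBmAt_inr_inr`).
* §3 the dressed generator at coarse multiplier legs is the BARE generator's field leg: `Gᵛ (Lc•z′) (inr m) = Lc^{−(d+1)}·ctGen d α Lc μ y z′ (inl m)`.
* §4 THE HEADLINE (`contact_inl_inl_of_ff`, `e3OfK_coDress_S0NAt_bref_inl_inl`): the field–field block of the level-1 contact is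
  `c · conjV 𝕄 (diagK (ctGen d α Lc μ y))` for ANY `𝕄` with `𝕄 x′ z′ (inl a) (inl b) = KInv (Lc•x′) (Lc•z′) (inr a) (inr b)` (e.g.
  `𝕄 := mmRead Lc KInv = mmRead Lc Ĝ`, `mmRead_coDress`), `c = cVH / (Lc^{d+1} · Lc^{d+1})`; i.e. the `Ĝ`-jet `e3OfK Lc Ĝ S0NAt` satisfies,
  at level 1, an `hE3ff`-SHAPED law with that `𝕄` and that `c`, under `Odd Lc` and `2·cVH = −cE·Lc^{d+1}` — the `j = 0` instance of file 1's
  `e3OfK_bref_inl_inl_of_law` written out (`σ = 1`, `γ = cVH/Lc^{d+1}`).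

All declarations `[folklore]`; axioms standard.  Provenance: b2b-balaban β sub-cell, unit beta-an3 gen 30, 2026-08-20 (v2 = v1 split in two
files ≤ 400 lines, declarations and names unchanged); over file 1 (`E3CoDressedContact`) and `E3GenericReflection`, `CoDressedMmRead`,
`BorderedHessianRooted`, `AxialDressingRootedBmKernel` BY NAME; no existing file touched.
-/

open Finset
open scoped BigOperators
open Literature.Probability.LatticeModels (Torus.proj)
open Literature.MathematicalPhysics.QuantumFieldTheory
open Literature.MathematicalPhysics.QuantumFieldTheory.Balaban1983to89
open Literature.MathematicalPhysics.QuantumFieldTheory.Balaban1983to89.Beta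
open B12Sec2to5 (l1 l1_nonneg)
open ExpKernelCalculus (MKer comp Decays BiLoc VertexFamily summable_exp_shift')
open PolarizationSign (reflSign)
open KernelReflection (LegMap refK refK_apply)
open ResolventReflection (bref Φ refK_KInv)
open OneStepResolventKernel (Fib KInv LocStencil wsum proj_zsmul quo_zsmul)
open OneStepKernelFamily (colH vertexOfK vertexFamily_vertexOfK' abs_colH_le)
open BalabanStepJetsSucc (mmRead mmRead_inl_inl)
open AffineAveraging (box toSite)
open AveragingContours (blk off)
open AveragingContoursRooted (ctr ctrOff ctrOff_mem_box linAvgAt)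
open AveragingHessianKernels (ell)
open AveragingHessianKernelsRooted (linKerAt abs_linKerAt_le)
open RootedKernelReflection (off_zsmul)
open AxialProjector (blk_zsmul)
open KKTFluctuationKernel (delta1)
open LatticeForm (quo)
open Summit.QuantumFields.BalabanUV.Beta.ChartConjugation (conjV)
open Summit.QuantumFields.BalabanUV.Beta.ChartConjugationRelative (RelInv sandwich_conjV_rel)
open Summit.QuantumFields.BalabanUV.Beta.BorderedHessian (bhKAt bhKAt_inr_inl bhKAt_inr_inr ctGen ctGen_inl ctGen_inr diagK diagK_apply
  conjV_diagK_apply comp_axEc_diagK_comm linAvgAt_delta1_eq_pow_mul_linKerAt spr_bhKAt relInv_coDressKBmAt_KInv_bhKAt biLoc_diagK_ctGen cCT)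
open Summit.QuantumFields.BalabanUV.Beta.AxialDressingRooted (axEc axEc_inr_inr comp_axEc_apply spr_axEc coDressKBmAt spr_coDressKBmAt
  refK_coDressKBmAt coDressKBmAt_inr_inr mmRead_coDressKBmAt)
open Summit.QuantumFields.BalabanUV.Beta.SpineRooted (S0NAt e3OfK e3OfK_apply conjV_smul_right)
open Summit.QuantumFields.BalabanUV.Beta.TameKernelCalculus (Spr Loc)
open Summit.QuantumFields.BalabanUV.Beta.VertexReflectionContact (smul_diagK mmRead_neg vertexOfK_conjV_diagK summable_colH_mul_ctGen)
open Summit.QuantumFields.BalabanUV.Beta.E3GenericReflection (e3KLaw_ff_iff)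
open Summit.QuantumFields.BalabanUV.Beta.VertexSandwichTransport (sandwichLaw_ff_iff)

noncomputable section

namespace Summit.QuantumFields.BalabanUV.Beta.E3CoDressedContact

variable {d : ℕ}

/-! ## §1 The co-dressed level-1 resolvent: spread, reflection-invariant, relative inverse; rule `E∘𝕄∘A = E` on a coarse entry -/

section Generic

variable {A : MKer (d + 1) (Fib d)}

/-- [folklore] **RULE `E ∘ 𝕄 ∘ A = E` READ ON A MULTIPLIER–MULTIPLIER ENTRY AT COARSE SITES.**  For a spread `A` with
`(axEc ρ N ∘ bhKAt d ρ N) ∘ A = axEc ρ N` (rule 4 of `RelInv A (bhKAt d ρ N) (axEc ρ N)`, in-block root `ρ = toSite r`), the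
`ℋ`-columns of `A` contracted against the rooted linearised kernel reproduce the coarse identity:
`Σ_κ Σ'_w colH A N μ′ y κ w · linKerAt ρ N m z′ (κ, w) = [z′ = y ∧ m = μ′] · N^{−(d+1)}`. -/
theorem sum_tsum_colH_mul_linKerAt_of_EMA {N : ℕ} [NeZero N] {r : Fin (d + 1) → ℕ} (hr : r ∈ box (d + 1) N) (hA : Spr A)
    (hEMA : comp (comp (axEc (toSite r) N) (bhKAt d (toSite r) N)) A = axEc (toSite r) N) (m μ' : Fin (d + 1))
    (z' y : Fin (d + 1) → ℤ) :
    ∑ κ, ∑' w, colH A N μ' y κ w * linKerAt (toSite r) N m z' (κ, w) =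
      if z' = y ∧ m = μ' then ((N : ℝ) ^ (d + 1))⁻¹ else 0 := by
  classical
  have hN1 : 1 ≤ N := Nat.one_le_iff_ne_zero.mpr (NeZero.ne N)
  have hNR : ((N : ℝ) ^ (d + 1)) ≠ 0 := pow_ne_zero _ (by exact_mod_cast NeZero.ne N)
  have hsum : ∀ κ, Summable fun w => colH A N μ' y κ w * linKerAt (toSite r) N m z' (κ, w) :=
    fun κ => summable_colH_mul_linKerAt (E3GenericReflection.Spr.decays' hA) hN1 hr μ' y κ m z'
  -- the `(N•z′, N•y, inr m, inr μ′)` entry of `E∘𝕄∘A = E`, outer composition unfolded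
  have h : (∑' w, ∑ f, comp (axEc (toSite r) N) (bhKAt d (toSite r) N) ((N : ℤ) • z') w (Sum.inr m) f *
      A w ((N : ℤ) • y) f (Sum.inr μ')) = axEc (toSite r) N ((N : ℤ) • z') ((N : ℤ) • y) (Sum.inr m) (Sum.inr μ') :=
    congrFun (congrFun (congrFun (congrFun hEMA ((N : ℤ) • z')) ((N : ℤ) • y)) (Sum.inr m)) (Sum.inr μ')
  simp only [comp_axEc_apply, proj_zsmul, if_true, Fintype.sum_sum_type, bhKAt_inr_inl, bhKAt_inr_inr, zero_mul,
    Finset.sum_const_zero, add_zero, quo_zsmul, linAvgAt_delta1_eq_pow_mul_linKerAt, axEc_inr_inr, and_true] at h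
  -- `h : ∑' w, ∑ κ, N^{d+1} · linKerAt … (κ, w) · A w (N•y) (inl κ) (inr μ′) = [N•z′ = N•y ∧ m = μ′]`
  have hinj : ((N : ℤ) • z' = (N : ℤ) • y) ↔ z' = y :=
    ⟨fun h' => by simpa only [quo_zsmul] using congrArg (quo N) h', fun h' => by rw [h']⟩
  have h2 : ∑' w, ∑ κ, colH A N μ' y κ w * linKerAt (toSite r) N m z' (κ, w) =
      ((N : ℝ) ^ (d + 1))⁻¹ * (if (N : ℤ) • z' = (N : ℤ) • y ∧ m = μ' then 1 else 0) := by
    rw [← h, ← tsum_mul_left]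
    refine tsum_congr fun w => ?_
    rw [Finset.mul_sum]
    refine Finset.sum_congr rfl fun κ _ => ?_
    simp only [colH]
    rw [← mul_assoc, ← mul_assoc, inv_mul_cancel₀ hNR, one_mul, mul_comm]
  rw [Summable.tsum_finsetSum (fun κ _ => hsum κ)] at h2
  rw [h2]
  simp only [hinj]
  split_ifs <;> simp

end Generic

section Instance

variable {Lc : ℕ} [NeZero Lc]

/-- [folklore] `Ĝ := coDressKBmAt ρ_c Lc KInv` is spread (`AxialDressingRooted.spr_coDressKBmAt`, `E3LevelOneReflection.spr_KInv`). -/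
theorem spr_coDress (hLc : 1 ≤ Lc) : Spr (coDressKBmAt (ctr (d + 1) Lc) Lc (KInv (N := Lc) (d := d))) :=
  spr_coDressKBmAt hLc (ctrOff_mem_box hLc) E3LevelOneReflection.spr_KInv

/-- [folklore] `Ĝ` is fixed by the axis reflection `Φ Lc α` about the centre root, `Lc` odd (`AxialDressingRooted.refK_coDressKBmAt`,
`ResolventReflection.refK_KInv`). -/
theorem refK_coDress (hLc : Odd Lc) (α : Fin (d + 1)) :
    refK (Φ (d := d) Lc α) (coDressKBmAt (ctr (d + 1) Lc) Lc (KInv (N := Lc) (d := d))) =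
      coDressKBmAt (ctr (d + 1) Lc) Lc (KInv (N := Lc) (d := d)) :=
  refK_coDressKBmAt hLc E3LevelOneReflection.spr_KInv α (refK_KInv α)

/-- [folklore] `RelInv Ĝ (bhKAt d ρ_c Lc) (axEc ρ_c Lc)` — an2's rules 1–4 for the rooted bordered Hessian
(`BorderedHessian.relInv_coDressKBmAt_KInv_bhKAt`, centre root). -/
theorem relInv_coDress (hLc : 1 ≤ Lc) :
    RelInv (coDressKBmAt (ctr (d + 1) Lc) Lc (KInv (N := Lc) (d := d))) (bhKAt d (ctr (d + 1) Lc) Lc) (axEc (ctr (d + 1) Lc) Lc) :=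
  relInv_coDressKBmAt_KInv_bhKAt (ctrOff_mem_box hLc)

/-! ## §2 The contact of the dressed level-1 law, evaluated -/

/-- [folklore] **THE LEVEL-1 CONTACT OVER THE CO-DRESSED RESOLVENT IS THE `mm`-READ OF A DIAGONAL CONTACT CONJUGATED BY `Ĝ`**:
`−mmRead Lc (Ĝ ∘ conjV (bhKAt ρ_c Lc) (γ • diagK Gᵛ) ∘ Ĝ) = mmRead Lc (conjV Ĝ (diagK (γ·Gᵛ)))`, `Gᵛ` the `ℋ`-dressed generator of the
coarse bond `(μ, y)` with weights from `Ĝ`. -/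
theorem neg_mmRead_contact_sandwich (hLc : 1 ≤ Lc) (γ : ℝ) (α μ : Fin (d + 1)) (y : Fin (d + 1) → ℤ) :
    -mmRead Lc (comp (comp (coDressKBmAt (ctr (d + 1) Lc) Lc (KInv (N := Lc) (d := d)))
        (conjV (bhKAt d (ctr (d + 1) Lc) Lc) (γ • diagK (fun p c => ∑ κ, ∑' u,
          colH (coDressKBmAt (ctr (d + 1) Lc) Lc (KInv (N := Lc) (d := d))) Lc μ y κ u * ctGen d α Lc κ u p c))))
        (coDressKBmAt (ctr (d + 1) Lc) Lc (KInv (N := Lc) (d := d)))) =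
      mmRead Lc (conjV (coDressKBmAt (ctr (d + 1) Lc) Lc (KInv (N := Lc) (d := d))) (diagK fun p c => γ * ∑ κ, ∑' u,
        colH (coDressKBmAt (ctr (d + 1) Lc) Lc (KInv (N := Lc) (d := d))) Lc μ y κ u * ctGen d α Lc κ u p c)) := by
  have hM : Spr (bhKAt d (ctr (d + 1) Lc) Lc) := spr_bhKAt hLc (ctrOff_mem_box hLc)
  rw [sandwich_conjV_smul_diagK (ctr (d + 1) Lc) Lc (spr_coDress hLc) hM (relInv_coDress hLc) γ
    (loc_diagK_dressedGen (spr_coDress hLc) α μ y), mmRead_neg, neg_neg]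

/-- [folklore] The same, scalar outside: `−mmRead Lc (Ĝ ∘ conjV (bhKAt ρ_c Lc) (γ • diagK Gᵛ) ∘ Ĝ) = mmRead Lc (conjV Ĝ (γ • diagK Gᵛ))`. -/
theorem neg_mmRead_contact_sandwich' (hLc : 1 ≤ Lc) (γ : ℝ) (α μ : Fin (d + 1)) (y : Fin (d + 1) → ℤ) :
    -mmRead Lc (comp (comp (coDressKBmAt (ctr (d + 1) Lc) Lc (KInv (N := Lc) (d := d)))
        (conjV (bhKAt d (ctr (d + 1) Lc) Lc) (γ • diagK (fun p c => ∑ κ, ∑' u,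
          colH (coDressKBmAt (ctr (d + 1) Lc) Lc (KInv (N := Lc) (d := d))) Lc μ y κ u * ctGen d α Lc κ u p c))))
        (coDressKBmAt (ctr (d + 1) Lc) Lc (KInv (N := Lc) (d := d)))) =
      mmRead Lc (conjV (coDressKBmAt (ctr (d + 1) Lc) Lc (KInv (N := Lc) (d := d))) (γ • diagK fun p c => ∑ κ, ∑' u,
        colH (coDressKBmAt (ctr (d + 1) Lc) Lc (KInv (N := Lc) (d := d))) Lc μ y κ u * ctGen d α Lc κ u p c)) := by
  rw [neg_mmRead_contact_sandwich hLc γ α μ y, ← smul_diagK]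

/-- [folklore] **FIELD–FIELD ENTRIES OF THE LEVEL-1 CONTACT**: at `(x′, z′, inl a, inl b)` the contact is
`γ · KInv (Lc•x′) (Lc•z′) (inr a) (inr b) · (Gᵛ (Lc•z′) (inr b) − Gᵛ (Lc•x′) (inr a))` — the multiplier–multiplier block of `Ĝ` is that
of `KInv` (`AxialDressingRooted.coDressKBmAt_inr_inr`) and a diagonal contact is entrywise `𝕄 · (g z b − g x a)`. -/
theorem neg_mmRead_contact_sandwich_inl_inl (hLc : 1 ≤ Lc) (γ : ℝ) (α μ : Fin (d + 1)) (y x' z' : Fin (d + 1) → ℤ)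
    (a b : Fin (d + 1)) :
    (-mmRead Lc (comp (comp (coDressKBmAt (ctr (d + 1) Lc) Lc (KInv (N := Lc) (d := d)))
        (conjV (bhKAt d (ctr (d + 1) Lc) Lc) (γ • diagK (fun p c => ∑ κ, ∑' u,
          colH (coDressKBmAt (ctr (d + 1) Lc) Lc (KInv (N := Lc) (d := d))) Lc μ y κ u * ctGen d α Lc κ u p c))))
        (coDressKBmAt (ctr (d + 1) Lc) Lc (KInv (N := Lc) (d := d))))) x' z' (Sum.inl a) (Sum.inl b) =
      γ * (KInv (N := Lc) (d := d) ((Lc : ℤ) • x') ((Lc : ℤ) • z') (Sum.inr a) (Sum.inr b) *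
        ((∑ κ, ∑' u, colH (coDressKBmAt (ctr (d + 1) Lc) Lc (KInv (N := Lc) (d := d))) Lc μ y κ u *
            ctGen d α Lc κ u ((Lc : ℤ) • z') (Sum.inr b)) -
          ∑ κ, ∑' u, colH (coDressKBmAt (ctr (d + 1) Lc) Lc (KInv (N := Lc) (d := d))) Lc μ y κ u *
            ctGen d α Lc κ u ((Lc : ℤ) • x') (Sum.inr a))) := by
  rw [neg_mmRead_contact_sandwich hLc γ α μ y, mmRead_inl_inl, conjV_diagK_apply, coDressKBmAt_inr_inr]
  ring

/-! ## §3 The dressed generator at coarse multiplier legs is the bare generator's field leg -/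

/-- [folklore] **`Σ_κ Σ'_u colH Ĝ Lc μ y κ u · linKerAt ρ_c Lc m z′ (κ, u) = [z′ = y ∧ m = μ] / Lc^{d+1}`** — rule 4 of `RelInv Ĝ 𝕄 E`
read on the coarse multiplier entry `((Lc•z′, inr m), (Lc•y, inr μ))` (`sum_tsum_colH_mul_linKerAt_of_EMA`). -/
theorem sum_tsum_colH_coDress_mul_linKerAt (hLc : 1 ≤ Lc) (μ : Fin (d + 1)) (y : Fin (d + 1) → ℤ) (m : Fin (d + 1))
    (z' : Fin (d + 1) → ℤ) :
    ∑ κ, ∑' u, colH (coDressKBmAt (ctr (d + 1) Lc) Lc (KInv (N := Lc) (d := d))) Lc μ y κ u * linKerAt (ctr (d + 1) Lc) Lc m z' (κ, u) =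
      if z' = y ∧ m = μ then ((Lc : ℝ) ^ (d + 1))⁻¹ else 0 :=
  sum_tsum_colH_mul_linKerAt_of_EMA (r := ctrOff (d + 1) Lc) (ctrOff_mem_box hLc) (spr_coDress hLc) (relInv_coDress hLc).EMA m μ z' y

/-- [folklore] **THE `ℋ`-DRESSED GENERATOR AT A COARSE MULTIPLIER LEG IS THE BARE GENERATOR'S FIELD LEG, SCALED**:
`Gᵛ (Lc•z′) (inr m) = Lc^{−(d+1)} · ctGen d α Lc μ y z′ (inl m)` (both sides are `−Lc^{−(d+1)}·[z′ = y ∧ m = μ = α]`). -/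
theorem dressedGen_zsmul_inr (hLc : 1 ≤ Lc) (α μ : Fin (d + 1)) (y z' : Fin (d + 1) → ℤ) (m : Fin (d + 1)) :
    ∑ κ, ∑' u, colH (coDressKBmAt (ctr (d + 1) Lc) Lc (KInv (N := Lc) (d := d))) Lc μ y κ u *
        ctGen d α Lc κ u ((Lc : ℤ) • z') (Sum.inr m) =
      ((Lc : ℝ) ^ (d + 1))⁻¹ * ctGen d α Lc μ y z' (Sum.inl m) := by
  classical
  simp only [ctGen_inr, ctGen_inl, off_zsmul, blk_zsmul hLc, and_true]
  by_cases hm : m = α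
  · simp only [hm, if_true, mul_neg, tsum_neg, Finset.sum_neg_distrib]
    rw [sum_tsum_colH_coDress_mul_linKerAt hLc μ y α z']
    by_cases h2 : z' = y ∧ α = μ
    · rw [if_pos h2, if_pos ⟨h2.1, h2.2, h2.2.symm⟩, mul_neg, mul_one]
    · have h2' : ¬(z' = y ∧ α = μ ∧ μ = α) := fun h' => h2 ⟨h'.1, h'.2.1⟩
      rw [if_neg h2, if_neg h2', neg_zero, mul_zero]
  · have h2' : ¬(z' = y ∧ m = μ ∧ μ = α) := fun h' => hm (h'.2.1.trans h'.2.2)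
    simp only [hm, if_false, mul_zero, tsum_zero, Finset.sum_const_zero, if_neg h2']

/-! ## §4 The headline: the field–field block of the level-1 contact is `c · conjV 𝕄 (diagK ctGen)`, `c = cVH / Lc^{2(d+1)}` -/

/-- [folklore] **THE FIELD–FIELD BLOCK OF THE LEVEL-1 CONTACT OVER THE CO-DRESSED RESOLVENT**: for ANY kernel `𝕄` whose field–field
block is the coarse multiplier–multiplier block of the one-step resolvent, `𝕄 x′ z′ (inl a) (inl b) = KInv (Lc•x′) (Lc•z′) (inr a) (inr b)`,
`(−mmRead Lc (Ĝ ∘ conjV (bhKAt ρ_c Lc) ((cVH/Lc^{d+1}) • diagK Gᵛ_{μ,y}) ∘ Ĝ)) x′ z′ (inl a) (inl b)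
   = (cVH / (Lc^{d+1}·Lc^{d+1})) · conjV 𝕄 (diagK (ctGen d α Lc μ y)) x′ z′ (inl a) (inl b)`. -/
theorem contact_inl_inl_of_ff (hLc : 1 ≤ Lc) (cVH : ℝ) {𝕄 : MKer (d + 1) (Fib d)}
    (h𝕄 : ∀ (x z : Fin (d + 1) → ℤ) (a b : Fin (d + 1)),
      𝕄 x z (Sum.inl a) (Sum.inl b) = KInv (N := Lc) (d := d) ((Lc : ℤ) • x) ((Lc : ℤ) • z) (Sum.inr a) (Sum.inr b))
    (α μ : Fin (d + 1)) (y x' z' : Fin (d + 1) → ℤ) (a b : Fin (d + 1)) :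
    (-mmRead Lc (comp (comp (coDressKBmAt (ctr (d + 1) Lc) Lc (KInv (N := Lc) (d := d)))
        (conjV (bhKAt d (ctr (d + 1) Lc) Lc) ((cVH / (Lc : ℝ) ^ (d + 1)) • diagK (fun p c => ∑ κ, ∑' u,
          colH (coDressKBmAt (ctr (d + 1) Lc) Lc (KInv (N := Lc) (d := d))) Lc μ y κ u * ctGen d α Lc κ u p c))))
        (coDressKBmAt (ctr (d + 1) Lc) Lc (KInv (N := Lc) (d := d))))) x' z' (Sum.inl a) (Sum.inl b) =
      cVH / ((Lc : ℝ) ^ (d + 1) * (Lc : ℝ) ^ (d + 1)) * conjV 𝕄 (diagK (ctGen d α Lc μ y)) x' z' (Sum.inl a) (Sum.inl b) := by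
  rw [neg_mmRead_contact_sandwich_inl_inl hLc _ α μ y, dressedGen_zsmul_inr hLc α μ y z' b, dressedGen_zsmul_inr hLc α μ y x' a,
    conjV_diagK_apply, h𝕄]
  ring

/-- [folklore] The same with `𝕄 := mmRead Lc KInv` (= `mmRead Lc Ĝ`, `AxialDressingRooted.mmRead_coDressKBmAt`): the contact's field–field
block is `(cVH / Lc^{2(d+1)}) · conjV (mmRead Lc KInv) (diagK (ctGen d α Lc μ y))`. -/
theorem contact_inl_inl (hLc : 1 ≤ Lc) (cVH : ℝ) (α μ : Fin (d + 1)) (y x' z' : Fin (d + 1) → ℤ) (a b : Fin (d + 1)) :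
    (-mmRead Lc (comp (comp (coDressKBmAt (ctr (d + 1) Lc) Lc (KInv (N := Lc) (d := d)))
        (conjV (bhKAt d (ctr (d + 1) Lc) Lc) ((cVH / (Lc : ℝ) ^ (d + 1)) • diagK (fun p c => ∑ κ, ∑' u,
          colH (coDressKBmAt (ctr (d + 1) Lc) Lc (KInv (N := Lc) (d := d))) Lc μ y κ u * ctGen d α Lc κ u p c))))
        (coDressKBmAt (ctr (d + 1) Lc) Lc (KInv (N := Lc) (d := d))))) x' z' (Sum.inl a) (Sum.inl b) =
      cVH / ((Lc : ℝ) ^ (d + 1) * (Lc : ℝ) ^ (d + 1)) *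
        conjV (mmRead Lc (KInv (N := Lc) (d := d))) (diagK (ctGen d α Lc μ y)) x' z' (Sum.inl a) (Sum.inl b) :=
  contact_inl_inl_of_ff hLc cVH (fun x z a b => mmRead_inl_inl Lc _ x z a b) α μ y x' z' a b

/-- [folklore] `mmRead Lc Ĝ = mmRead Lc KInv` (`AxialDressingRooted.mmRead_coDressKBmAt`): the admissible `𝕄 := mmRead Lc Ĝ` reads the
same field–field block. -/
theorem mmRead_coDress :
    mmRead Lc (coDressKBmAt (ctr (d + 1) Lc) Lc (KInv (N := Lc) (d := d))) = mmRead Lc (KInv (N := Lc) (d := d)) :=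
  mmRead_coDressKBmAt _ _ Lc _

/-- [folklore] **THE `Ĝ`-JET OBEYS AN `hE3ff`-SHAPED LAW AT LEVEL 1, CONTACT EVALUATED.**  Under `Odd Lc` and `2·cVH = −cE·Lc^{d+1}`,
for any `𝕄` with field–field block `KInv (Lc•·) (Lc•·) (inr ·) (inr ·)`, the value-function jet over the co-dressed resolvent
`e3OfK Lc Ĝ (S0NAt d Lc ρ_c cE cVH cΛ)` satisfies on field–field entries
`e3 κ′ (bref α κ′ u) x z (inl a) (inl b) = ε · (s_a s_b · (e3 κ′ u (r_a x) (r_b z) (inl a) (inl b)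
   + (cVH / (Lc^{d+1}·Lc^{d+1})) · conjV 𝕄 (diagK (ctGen d α Lc κ′ u)) (r_a x) (r_b z) (inl a) (inl b)))`
— the shape of the binder `hE3ff` of `StepReflection.SstepNAt_bref_of_e3Law` with `c = cVH / Lc^{2(d+1)}`
(`E3GenericReflection.e3KLaw_ff_iff` + `contact_inl_inl_of_ff`).  The fm/mf/mm blocks of `𝕄` are free here (they do not enter a field–field
contact entry); fitting them to the step family is the row owner's choice. -/
theorem e3OfK_coDress_S0NAt_bref_inl_inl (hLc : Odd Lc) {cE cVH : ℝ} (cΛ : ℝ) (hn : 2 * cVH = -(cE * (Lc : ℝ) ^ (d + 1)))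
    {𝕄 : MKer (d + 1) (Fib d)}
    (h𝕄 : ∀ (x z : Fin (d + 1) → ℤ) (a b : Fin (d + 1)),
      𝕄 x z (Sum.inl a) (Sum.inl b) = KInv (N := Lc) (d := d) ((Lc : ℤ) • x) ((Lc : ℤ) • z) (Sum.inr a) (Sum.inr b))
    (α κ' : Fin (d + 1)) (u x z : Fin (d + 1) → ℤ) (a b : Fin (d + 1)) :
    e3OfK Lc (coDressKBmAt (ctr (d + 1) Lc) Lc (KInv (N := Lc) (d := d))) (S0NAt d Lc (ctr (d + 1) Lc) cE cVH cΛ) κ' (bref α κ' u)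
        x z (Sum.inl a) (Sum.inl b) =
      reflSign α κ' * ((Φ (d := d) Lc α).s (Sum.inl a) * (Φ (d := d) Lc α).s (Sum.inl b) *
        (e3OfK Lc (coDressKBmAt (ctr (d + 1) Lc) Lc (KInv (N := Lc) (d := d))) (S0NAt d Lc (ctr (d + 1) Lc) cE cVH cΛ) κ' u
            ((Φ (d := d) Lc α).r (Sum.inl a) x) ((Φ (d := d) Lc α).r (Sum.inl b) z) (Sum.inl a) (Sum.inl b) +
          cVH / ((Lc : ℝ) ^ (d + 1) * (Lc : ℝ) ^ (d + 1)) *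
            conjV 𝕄 (diagK (ctGen d α Lc κ' u)) ((Φ (d := d) Lc α).r (Sum.inl a) x) ((Φ (d := d) Lc α).r (Sum.inl b) z)
              (Sum.inl a) (Sum.inl b))) := by
  have hlaw := (e3KLaw_ff_iff hLc cΛ hn (spr_coDress hLc.pos) (refK_coDress hLc α) κ' u
    (fun p q e f => cVH / ((Lc : ℝ) ^ (d + 1) * (Lc : ℝ) ^ (d + 1)) * conjV 𝕄 (diagK (ctGen d α Lc κ' u)) p q e f)).2
    (fun x' z' a' b' => contact_inl_inl_of_ff hLc.pos cVH h𝕄 α κ' u x' z' a' b') x z a b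
  simp only [e3OfK_apply]
  simpa only [Pi.neg_apply] using hlaw

/-- [folklore] The same with `𝕄 := mmRead Lc KInv`. -/
theorem e3OfK_coDress_S0NAt_bref_inl_inl_mmRead (hLc : Odd Lc) {cE cVH : ℝ} (cΛ : ℝ)
    (hn : 2 * cVH = -(cE * (Lc : ℝ) ^ (d + 1))) (α κ' : Fin (d + 1)) (u x z : Fin (d + 1) → ℤ) (a b : Fin (d + 1)) :
    e3OfK Lc (coDressKBmAt (ctr (d + 1) Lc) Lc (KInv (N := Lc) (d := d))) (S0NAt d Lc (ctr (d + 1) Lc) cE cVH cΛ) κ' (bref α κ' u)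
        x z (Sum.inl a) (Sum.inl b) =
      reflSign α κ' * ((Φ (d := d) Lc α).s (Sum.inl a) * (Φ (d := d) Lc α).s (Sum.inl b) *
        (e3OfK Lc (coDressKBmAt (ctr (d + 1) Lc) Lc (KInv (N := Lc) (d := d))) (S0NAt d Lc (ctr (d + 1) Lc) cE cVH cΛ) κ' u
            ((Φ (d := d) Lc α).r (Sum.inl a) x) ((Φ (d := d) Lc α).r (Sum.inl b) z) (Sum.inl a) (Sum.inl b) +
          cVH / ((Lc : ℝ) ^ (d + 1) * (Lc : ℝ) ^ (d + 1)) *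
            conjV (mmRead Lc (KInv (N := Lc) (d := d))) (diagK (ctGen d α Lc κ' u)) ((Φ (d := d) Lc α).r (Sum.inl a) x)
              ((Φ (d := d) Lc α).r (Sum.inl b) z) (Sum.inl a) (Sum.inl b))) :=
  e3OfK_coDress_S0NAt_bref_inl_inl hLc cΛ hn (fun x' z' a' b' => mmRead_inl_inl Lc _ x' z' a' b') α κ' u x z a b

end Instance

end Summit.QuantumFields.BalabanUV.Beta.E3CoDressedContact

end
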